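import Summits.SmoothPoincare4.SmoothPoincare4.Theses.EntropyRung
import Literature.Geometry.Riemannian.RoundCylinderFourVolume

/-!
# The bound of `NoncompactShrinkerGap` is attained: tightness lemmas (crux stmt-SmoothPoincare4-10868)

The crux `EntropyRung.NoncompactShrinkerGap` bounds `∫ e^{-f} dV` by `32π²√π e^{-3/2} = (4π)²·Θ(S³×ℝ)`
for complete non-compact non-flat normalised 4-d gradient shrinkers. This file records, kernel-checked
over the tree's vocabulary, that the constant is SHARP and the non-strict `≤` is NECESSARY:

* `noncompactShrinkerGap_tight_at_cylinder` — the round cylinder `S³(2) × ℝ`, realised as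
  `(ℝ⁴ ∖ 0, (4/|y|²)δ)` with `f = (log|y|)² + 3/2` (`Literature/Geometry/Riemannian/RoundCylinderFour*`:
  `Ric = ½g − ½dz²`, `Hess f = ½dz²`, `R = 3/2`, `|∇f|² = z²/4`, complete, connected, non-compact),
  satisfies EVERY hypothesis of the crux with `∫ e^{-f} dV = 32π²√π e^{-3/2}` exactly
  (Cao–Hamilton–Ilmanen 2004 §4: `Θ(S³×ℝ) = 2√π e^{-3/2} = .791`);
* `noncompactShrinkerGap_not_strict` — hence the strict form (`<`) of the crux is false;
* `noncompactShrinkerGap_not_le_nextCompetitor` — and the natural strengthening replacing the constant by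
  the next entry of CHI's table, `(4π)²·Θ(S²×ℝ²) = 32π²/e` (`Θ(S²×ℝ²) = 2/e = .736`), is false as well
  (`2/e < 2√πe^{-3/2} ⟺ e < π`, `densityS2R2_lt_cylinderDensityBound`).

Refuter tightness lemmas (cdisprove gen 1–2), support the crux item.
-/

noncomputable section

set_option linter.dupNamespace false

namespace Summit.SmoothPoincare4.SmoothPoincare4.Theorems.NoncompactShrinkerGap.Negative

open scoped Manifold ContDiff ENNReal NNReal RealInnerProductSpace ContinuousMap
open MeasureTheory
open Literature.Geometry.Riemannian Literature.Geometry.Lorentzian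
open Literature.Geometry.Lorentzian.PseudoRiemannianMetric

/-- A point of the cylinder chart `ℝ⁴ ∖ 0`. [folklore] -/
theorem roundCylinderFour_point_mem :
    EuclideanSpace.single (0 : Fin 4) (1 : ℝ) ∈ ({(0 : EuclideanFour)}ᶜ : Set EuclideanFour) := by
  simp

/-- **Tightness**: the bound of the crux is ATTAINED by the round cylinder `S³(2) × ℝ`
(`(ℝ⁴ ∖ 0, (4/|y|²)δ)`, `f = (log|y|)² + 3/2`), which meets every hypothesis of `NoncompactShrinkerGap`
with `∫ e^{-f} dV = 32π²√π e^{-3/2}` EXACTLY. Hence the constant cannot be lowered.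
[cite: CaoHamiltonIlmanen2004, §4] -/
theorem noncompactShrinkerGap_tight_at_cylinder :
    ∃ (M : Type) (_ : TopologicalSpace M) (_ : T2Space M) (_ : SecondCountableTopology M)
      (_ : ChartedSpace (EuclideanSpace ℝ (Fin 4)) M) (_ : IsManifold (𝓡 4) ∞ M)
      (_ : ConnectedSpace M) (_ : NoncompactSpace M) (_ : T3Space M) (_ : MeasurableSpace M)
      (_ : BorelSpace M)
      (g : PseudoRiemannianMetric (𝓡 4) ∞ (EuclideanSpace ℝ (Fin 4)) (TangentSpace (𝓡 4) : M → Type _))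
      (_ : g.HasLeviCivita) (f : M → ℝ) (hg : g.IsRiemannian),
      (∀ (x : M) (r : NNReal), IsCompact {y : M | g.edist hg x y ≤ r}) ∧
      ContMDiff (𝓡 4) 𝓘(ℝ, ℝ) ∞ f ∧
      (∀ (x : M) (X Y : TangentSpace (𝓡 4) x),
        g.ricci x X Y + g.hessian f x X Y = (1 / 2 : ℝ) * g.val x X Y) ∧
      (∀ x : M, g.scalarCurvature x + g.gradSq f x = f x) ∧
      (∃ x : M, g.scalarCurvature x ≠ 0) ∧
      ∫⁻ x, ENNReal.ofReal (Real.exp (-f x))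
          ∂(riemannianMeasure (g.toContMDiffRiemannianMetric hg)) =
        ENNReal.ofReal (32 * Real.pi ^ 2 * Real.sqrt Real.pi * Real.exp (-(3 : ℝ) / 2)) := by
  have hpt : RoundCylinderFour.P4 := ⟨EuclideanSpace.single 0 1, roundCylinderFour_point_mem⟩
  exact ⟨RoundCylinderFour.P4, inferInstance, inferInstance, inferInstance, inferInstance,
    inferInstance, inferInstance, inferInstance, inferInstance, inferInstance, inferInstance,
    RoundCylinderFour.cylP, inferInstance, RoundCylinderFour.fP, RoundCylinderFour.isRiemannian_cylP,
    RoundCylinderFour.isCompact_setOf_edist_le, RoundCylinderFour.contMDiff_fP,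
    RoundCylinderFour.soliton, RoundCylinderFour.normalisation,
    ⟨hpt, RoundCylinderFour.scalarCurvature_ne_zero hpt⟩, RoundCylinderFour.lintegral_exp_neg_fP⟩

/-- **The strict form of the crux is false** (`<` instead of `≤`): the round cylinder attains the bound.
[cite: CaoHamiltonIlmanen2004, §4] -/
theorem noncompactShrinkerGap_not_strict :
    ¬ ∀ (M : Type) [TopologicalSpace M] [T2Space M] [SecondCountableTopology M]
      [ChartedSpace (EuclideanSpace ℝ (Fin 4)) M] [IsManifold (𝓡 4) ∞ M] [ConnectedSpace M]
      [NoncompactSpace M] [T3Space M] [MeasurableSpace M] [BorelSpace M]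
      (g : PseudoRiemannianMetric (𝓡 4) ∞ (EuclideanSpace ℝ (Fin 4)) (TangentSpace (𝓡 4) : M → Type _))
      [g.HasLeviCivita] (f : M → ℝ) (hg : g.IsRiemannian),
      (∀ (x : M) (r : NNReal), IsCompact {y : M | g.edist hg x y ≤ r}) →
      ContMDiff (𝓡 4) 𝓘(ℝ, ℝ) ∞ f →
      (∀ (x : M) (X Y : TangentSpace (𝓡 4) x),
        g.ricci x X Y + g.hessian f x X Y = (1 / 2 : ℝ) * g.val x X Y) →
      (∀ x : M, g.scalarCurvature x + g.gradSq f x = f x) →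
      (∃ x : M, g.scalarCurvature x ≠ 0) →
      ∫⁻ x, ENNReal.ofReal (Real.exp (-f x))
          ∂(riemannianMeasure (g.toContMDiffRiemannianMetric hg)) <
        ENNReal.ofReal (32 * Real.pi ^ 2 * Real.sqrt Real.pi * Real.exp (-(3 : ℝ) / 2)) := by
  intro h
  have hpt : RoundCylinderFour.P4 := ⟨EuclideanSpace.single 0 1, roundCylinderFour_point_mem⟩
  have key := h RoundCylinderFour.P4 RoundCylinderFour.cylP RoundCylinderFour.fP
    RoundCylinderFour.isRiemannian_cylP RoundCylinderFour.isCompact_setOf_edist_le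
    RoundCylinderFour.contMDiff_fP RoundCylinderFour.soliton RoundCylinderFour.normalisation
    ⟨hpt, RoundCylinderFour.scalarCurvature_ne_zero hpt⟩
  change ∫⁻ p, ENNReal.ofReal (Real.exp (-RoundCylinderFour.fP p))
      ∂(riemannianMeasure RoundCylinderFour.hC) < _ at key
  rw [RoundCylinderFour.lintegral_exp_neg_fP] at key
  exact lt_irrefl _ key

/-- CHI's ordering of the two non-compact product shrinkers, multiplied by `(4π)² = 16π²`:
`(4π)²·Θ(S²×ℝ²) = 32π²/e < 32π²√π e^{-3/2} = (4π)²·Θ(S³×ℝ)` (`⟺ e < π`; gap `.055`). [folklore] -/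
theorem densityS2R2_lt_cylinderDensityBound :
    32 * Real.pi ^ 2 / Real.exp 1 <
      32 * Real.pi ^ 2 * Real.sqrt Real.pi * Real.exp (-(3 : ℝ) / 2) := by
  have hπ : Real.exp 1 < Real.pi := lt_trans Real.exp_one_lt_d9 (by linarith [Real.pi_gt_d2])
  have h1 : Real.exp (1 / 2) < Real.sqrt Real.pi := by
    rw [Real.lt_sqrt (Real.exp_pos _).le, ← Real.exp_nat_mul]
    norm_num
    exact hπ
  have h2 : Real.exp (-(3 : ℝ) / 2) = (Real.exp 1)⁻¹ * (Real.exp (1 / 2))⁻¹ := by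
    rw [← Real.exp_neg, ← Real.exp_neg, ← Real.exp_add]
    norm_num
  have h3 : 1 < Real.sqrt Real.pi * (Real.exp (1 / 2))⁻¹ := by
    rw [lt_mul_inv_iff₀ (Real.exp_pos _), one_mul]
    exact h1
  rw [h2, div_eq_mul_inv]
  calc 32 * Real.pi ^ 2 * (Real.exp 1)⁻¹ = 32 * Real.pi ^ 2 * (Real.exp 1)⁻¹ * 1 := (mul_one _).symm
    _ < 32 * Real.pi ^ 2 * (Real.exp 1)⁻¹ * (Real.sqrt Real.pi * (Real.exp (1 / 2))⁻¹) :=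
        mul_lt_mul_of_pos_left h3 (by positivity)
    _ = _ := by ring

/-- **The next-competitor strengthening is false**: replacing the constant of the crux by
`(4π)²·Θ(S²×ℝ²) = 32π²/e` (the density of the second non-compact product shrinker `S²×ℝ²`,
`Θ = 2/e = .736`, CHI 2004 §4) gives a false statement — the round cylinder has
`∫ e^{-f} dV = 32π²√πe^{-3/2} > 32π²/e`. So `Θ(S³×ℝ)` is the least constant for which the crux can
hold, and no proof can route through a bound by the `S²×ℝ²` density. [cite: CaoHamiltonIlmanen2004, §4] -/
theorem noncompactShrinkerGap_not_le_nextCompetitor :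
    ¬ ∀ (M : Type) [TopologicalSpace M] [T2Space M] [SecondCountableTopology M]
      [ChartedSpace (EuclideanSpace ℝ (Fin 4)) M] [IsManifold (𝓡 4) ∞ M] [ConnectedSpace M]
      [NoncompactSpace M] [T3Space M] [MeasurableSpace M] [BorelSpace M]
      (g : PseudoRiemannianMetric (𝓡 4) ∞ (EuclideanSpace ℝ (Fin 4)) (TangentSpace (𝓡 4) : M → Type _))
      [g.HasLeviCivita] (f : M → ℝ) (hg : g.IsRiemannian),
      (∀ (x : M) (r : NNReal), IsCompact {y : M | g.edist hg x y ≤ r}) →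
      ContMDiff (𝓡 4) 𝓘(ℝ, ℝ) ∞ f →
      (∀ (x : M) (X Y : TangentSpace (𝓡 4) x),
        g.ricci x X Y + g.hessian f x X Y = (1 / 2 : ℝ) * g.val x X Y) →
      (∀ x : M, g.scalarCurvature x + g.gradSq f x = f x) →
      (∃ x : M, g.scalarCurvature x ≠ 0) →
      ∫⁻ x, ENNReal.ofReal (Real.exp (-f x))
          ∂(riemannianMeasure (g.toContMDiffRiemannianMetric hg)) ≤
        ENNReal.ofReal (32 * Real.pi ^ 2 / Real.exp 1) := by
  intro h
  have hpt : RoundCylinderFour.P4 := ⟨EuclideanSpace.single 0 1, roundCylinderFour_point_mem⟩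
  have key := h RoundCylinderFour.P4 RoundCylinderFour.cylP RoundCylinderFour.fP
    RoundCylinderFour.isRiemannian_cylP RoundCylinderFour.isCompact_setOf_edist_le
    RoundCylinderFour.contMDiff_fP RoundCylinderFour.soliton RoundCylinderFour.normalisation
    ⟨hpt, RoundCylinderFour.scalarCurvature_ne_zero hpt⟩
  change ∫⁻ p, ENNReal.ofReal (Real.exp (-RoundCylinderFour.fP p))
      ∂(riemannianMeasure RoundCylinderFour.hC) ≤ _ at key
  rw [RoundCylinderFour.lintegral_exp_neg_fP, ENNReal.ofReal_le_ofReal_iff (by positivity)] at key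
  exact absurd key (not_le.mpr densityS2R2_lt_cylinderDensityBound)

end Summit.SmoothPoincare4.SmoothPoincare4.Theorems.NoncompactShrinkerGap.Negative

end
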